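import Summits.QuantumFields.BalabanUV.T4Continuum.Support.ShellMeasureLinearizedEndGammaT
import Summits.QuantumFields.BalabanUV.T4Continuum.Support.ShellMeasureLinearizedGammaTLocalEnd

/-!
# `T4Continuum.ShellMeasureLinearizedEndGammaTLocal` — NE7c-S91 «γ3′ (LR)_j LOCAL», file 3: THE W-d PLUG OF RECORD
# (row S60 `slotAC_linearizedWindow_gammaT(_matrix)`) RE-FIRED WITH THE LOCATED REGULARITY BINDER — loops AT `c` ∕
# plaquettes ON THE TWO-BLOCK BOX OF `c`, nothing outside
(cell `pub-balaban`, sub-cell `t4`, spine estimate NE7c (node U5b); NE7c ROUND-2 crew `t4-ne7c-formalise-*`, seat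
`b2b-balaban-t4-ne7c-formalise-leaf-07` gen 8; owner table `t4/b2b-balaban-t4-ne7c-p1/LEAVES-NE7c-P1.md` v3.8 ROW S91 :=
leaf-07-g8 (R-ne7cp1-g33-2 (a): FINDING F-ne7cleaf07g8-1 ACCEPTED; «file 2 = the S60-type plug with the located binder»);
imports S60 `ShellMeasureLinearizedEndGammaT` (p220060; hence `ShellMeasureLinearizedEndFromQ`) + file 2
`ShellMeasureLinearizedGammaTLocalEnd` ONLY, everything BY NAME; [folklore]; 0 `def`, 0 `def … : Prop`, 0 sorry, 0 citations)

HONEST FRAMING.  Finite four-torus programme, rung (B)+1 only — NOT infinite volume, NOT a mass gap, NOT the Clay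
problem, NOT summit progress; (B), `BetaPertHyp`, (B^μ) not consumed.  NE7c (`T4IndicatorShell.ShellWeightBound`) is
NOT PRINTED and NOT PROVED; «NE7c ⇐ the named binders» (trigger c3).  What is KERNEL here is S60's kernel statement
with a WEAKER (located) regime binder; referee DV-26 still governs every headline: «(Q1)–(Q4) KERNEL UNDER THE REGIME
BINDER», never «p. 267 linearization proved for Bałaban's backgrounds».  The [dict] residual of W-d (node O: the slot's
DENSITY and tested variable read at the charted point; the identification of the background with `V = Q(U_{j,□})` and the
threshold `ε₀ := C(L)ε_j`, N-ne7cp1-g32-2 ∕ -g33-2) is DISPLAYED, untouched.  NOTHING in the countdown moves; spine PROVED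
0∕9.  HONEST DEPENDENCY (cell, verbatim): continuum YM on T⁴ ⇐ BetaPertH ∧ nine spine estimates (0/9 proved); BetaPertH ⇐
(D1) ∧ (D4) ∧ CAP+tail; G-an2-4 gates asym, D1 and NE2/3/4.

CONTENT.  §1 `fderiv_QtΓ_hopΓAt` (S46's `hLQh` at the Fréchet derivative of the analytic chart average, file 1
`fderiv_hopΓAt`; S60's `QtΓ_bound_one` is already per bond).  §2 **`slotAC_linearizedWindow_gammaT_local`** = S60 §2 with
`hW : ∀ z c′` ↦ `hWc : ∀ z, ∀ x ∈ offAxis L c` and `hopΓ`∕`hΓ` ↦ `hopΓAt`∕`hΓAt` (ONE call of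
`slotAC_linearizedWindow_of_Q`).  §3 **`slotAC_linearizedWindow_gammaT_local_matrix`** = S60 §3 with `h44 : ∀ z p` ↦ the box
binder `h44c` (file 2 `loopsAt_of_box`).  NON-VACUITY (rule G-1): the located regularity family is inhabited at `V ≡ 1`
(file 2 `nonvacuity_flat` ∕ `flat_unitary`); S60's global binder is the special case `P := univ` (global ⟹ local), so
S60 stays correct as filed and every inhabitant of its hypotheses is one of ours.
-/

noncomputable section

open Set Function MeasureTheory MeasureTheory.Measure Metric Filter Topology

namespace Summit.QuantumFields.BalabanUV.T4Continuum.ShellMeasureLinearizedEndGammaTLocal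

open scoped ENNReal NNReal
open Literature.MathematicalPhysics.QuantumFieldTheory.Balaban1983to89
open Literature.MathematicalPhysics.QuantumLattice (ZdEdge blockBase plaquetteHolonomyZd)
open B8Lemma1NonAbelian (pairTop omegaC omegaC_nonneg)
open B12PlaquetteLoop267 (thresholds_of_small)
open B7BlockGeometry (qppBonds)
open B12HOperator267 (gammaT)
open B12AverageCorridor267 (loopW offAxis)
open T4ShellMeasure (SlotAntiConcentration)
open ShellMeasureWilsonTrace (TraceData)
open ShellMeasureWilsonMoving (MLetter mwordEval mdFro sSum lSum)
open ShellMeasureLevelAssembly (classifier weight)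
open Summit.QuantumFields.BalabanUV.Beta.LinearizingChange267FromQ (nonlin Mq)
open ShellMeasureLinearizedRealStructure (realSub incl reP)
open ShellMeasureAverageDerivative (hop_bound_nonneg)
open ShellMeasureAverageAnalyticB7 (analyticOnNhd_Qtilde_gammaT)
open ShellMeasureLinearizedGammaT (QtΓ QtΓ_zero κ𝔸 κΓ κ𝔸_invol κΓ_invol TΓ DtΓℝ QtΓ_conj)
open ShellMeasureLinearizedGammaTLocal (hopΓAt hΓAt norm_hopΓAt_le fderiv_hopΓAt hopΓAt_star hGenAt_star_gammaT_unitary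
  loopsAt_of_box)
open ShellMeasureLinearizedEndFromQ (slotAC_linearizedWindow_of_Q)
open ShellMeasureLinearizedEndGammaT (QtΓ_bound_one)

variable {d : ℕ} {𝔸 : Type*} [NormedRing 𝔸] [NormedAlgebra ℂ 𝔸] [CompleteSpace 𝔸] [NormOneClass 𝔸]
  [StarRing 𝔸] [CStarRing 𝔸] [StarModule ℂ 𝔸] {L : ℕ} {c : ZdEdge d}

/-! ## §1 Per-background bookkeeping, located -/

omit [StarRing 𝔸] [CStarRing 𝔸] [StarModule ℂ 𝔸] in
/-- S46's `hLQh` FOR (15), LOCATED: `DQ̃_V(0) (hopΓAt X) = X` — file 1 `fderiv_hopΓAt` at the Fréchet derivative of the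
analytic chart average (S49 f2, loops AT `c`). [folklore] -/
theorem fderiv_QtΓ_hopΓAt (hL : 0 < L) {V : ZdEdge d → 𝔸ˣ} {ε : ℝ} (hε0 : 0 ≤ ε) (hε : ε ≤ 1 / 8)
    (hWc : ∀ x ∈ offAxis L c, ‖((loopW L (fun U : ZdEdge d → 𝔸ˣ => gammaT L U) V c x : 𝔸ˣ) : 𝔸) - 1‖ ≤ ε)
    (hV : ∀ b, ‖((V b : 𝔸ˣ) : 𝔸)‖ ≤ 1) (hV' : ∀ b, ‖(((V b)⁻¹ : 𝔸ˣ) : 𝔸)‖ ≤ 1)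
    (hbud : (L : ℝ) ^ d / L * (24 * ε) < 1) (X : 𝔸) :
    fderiv ℂ (QtΓ L V c) 0 (hopΓAt hL V hε0 hε c hWc hV hV' hbud X) = X := by
  have hLr : (0 : ℝ) < L := by exact_mod_cast hL
  have hR : (0 : ℝ) < 1 / (2816 * ((d : ℝ) + 1) * L) := by positivity
  exact fderiv_hopΓAt hL V hε0 hε c hWc hV hV' hbud
    ((analyticOnNhd_Qtilde_gammaT hL hV hV' hε0 hε hWc 0 (mem_ball_self hR)).differentiableAt.hasFDerivAt) X

/-! ## §2 The composed END for the printed average, located -/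

variable [FiniteDimensional ℂ 𝔸] [MeasurableSpace 𝔸] [BorelSpace 𝔸] [MeasurableSpace (↥(qppBonds L c) → 𝔸)]
  [BorelSpace (↥(qppBonds L c) → 𝔸)]

/-- **NE7c-S91 — THE W-d PLUG WITH THE LOCATED BINDER: the (LR)_j END for [B7] (15) from the loop regime AT `c` ONLY.**
Row S60's `slotAC_linearizedWindow_gammaT` (p220060) — statement, binders and conclusion VERBATIM — with the ONE change
that print's regime on the exterior-indexed background asks the `ε`-regularity of the off-axis block loops AT THE COARSE
BOND `c` (`hWc : ∀ z, ∀ x ∈ offAxis L c, …`), not at every coarse bond of `ℤᵈ`; accordingly `hop` ∕ the chart are file 1's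
`hopΓAt` ∕ `hΓAt` (= S52's `hopΓ` ∕ `hΓ` by `rfl` whenever the global binder holds).  `ShellMeasureLinearizedEndFromQ.
slotAC_linearizedWindow_of_Q` BY NAME with (Q1)(Q3) S49 f2, (Q2) S52 f1 `QtΓ_zero`, (Q4) S52 §1 `QtΓ_conj`, `hLQh` :=
`fderiv_QtΓ_hopΓAt`, `hHop` := `norm_hopΓAt_le`, `hhop` := `hopΓAt_star` ∘ `hGenAt_star_gammaT_unitary` — all per bond.
Everything displayed in S60 stays displayed (the [dict] of the density, SM-L1∕L3∕L4 for the OTHER terms, SM-L5∕L6,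
numbers + (SM)). [folklore] -/
theorem slotAC_linearizedWindow_gammaT_local (hL : 0 < L) (μE : Measure (realSub (κΓ 𝔸 L c))) [μE.IsAddHaarMeasure]
    {Kf : Type*} [NormedAddCommGroup Kf] [NormedSpace ℝ Kf] [MeasurableSpace Kf] [BorelSpace Kf]
    [FiniteDimensional ℝ Kf] (μK : Measure Kf) [μK.IsAddHaarMeasure]
    {A : Type*} [NormedRing A] [NormedAlgebra ℂ A] [CompleteSpace A] [NormOneClass A]
    {Z : Type*} [MeasurableSpace Z] (ζ : Measure Z) [SFinite ζ]
    -- PRINT'S REGIME on the exterior-indexed background, `ε` uniform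
    {V : Z → ZdEdge d → 𝔸ˣ} (hVu : ∀ z b, (V z b : 𝔸) ∈ unitary 𝔸)
    (hV : ∀ z b, ‖((V z b : 𝔸ˣ) : 𝔸)‖ ≤ 1) (hV' : ∀ z b, ‖(((V z b)⁻¹ : 𝔸ˣ) : 𝔸)‖ ≤ 1) {ε : ℝ} (hε0 : 0 ≤ ε)
    (hε : ε ≤ 1 / 8)
    (hWc : ∀ z, ∀ x ∈ offAxis L c, ‖((loopW L (fun U : ZdEdge d → 𝔸ˣ => gammaT L U) (V z) c x : 𝔸ˣ) : 𝔸) - 1‖ ≤ ε)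
    (hbud : (L : ℝ) ^ d / L * (24 * ε) < 1)
    -- the window radius
    {εw : ℝ} (hq2 : 9 * Mq (1 / (2816 * ((d : ℝ) + 1) * L)) 1 *
      (((L : ℝ) ^ d / L) / (1 - (L : ℝ) ^ d / L * (24 * ε))) * εw ≤ 1 / 2)
    (hRC : 3 * εw ≤ 1 / (2816 * ((d : ℝ) + 1) * L))
    -- a solution of print's fixed-point equation per exterior point
    {Dt : Z → (↥(qppBonds L c) → 𝔸) → 𝔸}
    (hDball : ∀ z, ∀ B : ↥(qppBonds L c) → 𝔸, ‖B‖ < εw →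
      Dt z B ∈ closedBall (0 : 𝔸) (4 * Mq (1 / (2816 * ((d : ℝ) + 1) * L)) 1 * εw ^ 2))
    (hDfix : ∀ z, ∀ B : ↥(qppBonds L c) → 𝔸, ‖B‖ < εw →
      nonlin (QtΓ L (V z) c) (B - hopΓAt hL (V z) hε0 hε c (hWc z) (hV z) (hV' z) hbud (Dt z B)) = Dt z B)
    -- the splitting along the real `DQ̃(0)` and its section
    (Ψ : Z → (Kf × realSub (κ𝔸 𝔸)) ≃L[ℝ] realSub (κΓ 𝔸 L c)) (hΨ : ∀ z y, ((Ψ z).symm y).2 = TΓ L (V z) c y)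
    {σ : Z → realSub (κ𝔸 𝔸) → realSub (κΓ 𝔸 L c)} (hσm : ∀ z, Measurable (σ z))
    (hσ : ∀ z a, ((Ψ z).symm (σ z a)).2 = a)
    -- the chart by its defining equation
    {Φ : Z → realSub (κΓ 𝔸 L c) → realSub (κΓ 𝔸 L c)}
    (hΦ : ∀ z, Φ z = fun B => B - hΓAt hL (V z) hε0 hε c (hWc z) (hV z) (hV' z) hbud (DtΓℝ L c (Dt z) εw B))
    -- the realized slot law
    {G : realSub (κΓ 𝔸 L c) × Z → ℝ≥0∞} (hG : Measurable G) {u : realSub (κΓ 𝔸 L c) × Z → ℝ} (hu : Measurable u)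
    (hGsupp : ∀ z y, G (y, z) ≠ 0 → y ∈ Φ z '' {y : realSub (κΓ 𝔸 L c) | ‖incl (κΓ 𝔸 L c) y‖ < εw})
    (hfin : ∀ z a, (μK.withDensity fun x => ({y : realSub (κΓ 𝔸 L c) | ‖incl (κΓ 𝔸 L c) y‖ < εw}).indicator
      (fun y => G (Φ z y, z)) (σ z a + Ψ z (x, 0))) univ ≠ ∞)
    -- level data per exterior point AND average value, in the fibre coordinate
    (Ttr : TraceData A) (hN : 0 < Ttr.N) {ι κ : Type*} {Pu : Finset ι} (hPu : Pu.Nonempty)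
    (hol : Z → realSub (κ𝔸 𝔸) → ι → Kf → A) (hcont : ∀ z a, ∀ p ∈ Pu, Continuous (hol z a p))
    (Pw : Finset κ) (Gw : Z → realSub (κ𝔸 𝔸) → κ → Kf → A) (𝓔 : Z → realSub (κ𝔸 𝔸) → Kf → ℝ)
    (W : Z → realSub (κ𝔸 𝔸) → Set Kf) (Jco : Z → realSub (κ𝔸 𝔸) → Kf → ℝ≥0∞) {θ δ ρ β Rad H B𝓔 r : ℝ}
    {sw lw dw : κ → ℝ}
    -- DICTIONARY at the charted point — the DENSITY ALONE
    (hFdict : ∀ z a x, ({y : realSub (κΓ 𝔸 L c) | ‖incl (κΓ 𝔸 L c) y‖ < εw}).indicator (fun y => G (Φ z y, z))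
      (σ z a + Ψ z (x, 0)) = Jco z a x * weight Ttr β Pw (Gw z a) (𝓔 z a) x)
    (hudict : ∀ z a x, ({y : realSub (κΓ 𝔸 L c) | ‖incl (κΓ 𝔸 L c) y‖ < εw}).indicator (fun y => G (Φ z y, z))
      (σ z a + Ψ z (x, 0)) ≠ 0 → u (Φ z (σ z a + Ψ z (x, 0)), z) = classifier hPu (hol z a) x)
    -- window placement
    (hWr : ∀ z a, ∀ x ∈ W z a, ‖σ z a‖ + Rad * ‖Ψ z (x, 0)‖ ≤ r) (hr0 : 0 ≤ r) (hrε : r < εw)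
    -- SM-L5/L6
    (hJW : ∀ z a x, Jco z a x ≠ 0 → x ∈ W z a)
    (hJ : ∀ z a x, ∀ a' : ℝ, 0 ≤ a' → Jco z a x ≤ Jco z a (Real.exp (-a') • x))
    -- SM-L1
    (hRad : 1 < Rad)
    (hAN : ∀ z a, ∀ x ∈ W z a, ∀ p ∈ Pu, ∃ f : ℂ → A, DifferentiableOn ℂ f (ball 0 Rad) ∧
      (∀ w ∈ ball (0 : ℂ) Rad, ‖f w‖ ≤ H) ∧ f 0 = 0 ∧
      ∀ c' : ℝ, 0 ≤ c' → c' ≤ 1 → f (c' : ℂ) = hol z a p (c' • x) - 1)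
    -- SM-L3
    (hGW : ∀ z a, ∀ x ∈ W z a, ∀ p ∈ Pw, ∃ gw : List (MLetter A × ℝ × ℝ), (∀ y ∈ gw, y.1.Good Ttr.τ y.2.1 y.2.2) ∧
      sSum gw ≤ sw p ∧ lSum gw ≤ lw p ∧ mdFro (gw.map Prod.fst) ≤ dw p ∧
      ∀ c' : ℝ, 0 ≤ c' → c' ≤ 1 → mwordEval c' (gw.map Prod.fst) = Gw z a p (c' • x))
    (hsw1 : ∀ p ∈ Pw, sw p ≤ 1) (hsw0 : ∀ p ∈ Pw, 0 ≤ sw p) (hlw0 : ∀ p ∈ Pw, 0 ≤ lw p)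
    (hdw0 : ∀ p ∈ Pw, 0 ≤ dw p)
    -- SM-L4 for the OTHER terms
    (hE : ∀ z a, ∀ x ∈ W z a, ∀ c' : ℝ, 1 / 2 ≤ c' → c' ≤ 1 → 𝓔 z a (c' • x) ≤ 𝓔 z a x + (1 - c') * B𝓔)
    (hB𝓔 : 0 ≤ B𝓔)
    -- numbers + (SM)
    (hθ : 0 < θ) (hδ0 : 0 ≤ δ) (hδ1 : δ < 1) (hρ0 : 0 ≤ ρ) (hρ : ρ ≤ (1 - δ) / 2) (hβ : 0 ≤ β)
    (hSM : 36 * H * 1 ^ 2 / (Rad - 1) ^ 2 ≤ δ * θ) :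
    SlotAntiConcentration ((μE.prod ζ).withDensity G) u θ ρ
      (2 * ((Module.finrank ℝ Kf : ℝ) + (β * ∑ p ∈ Pw, lw p * (dw p + 4 * sw p) +
        (B𝓔 + 3 * (2 * (Module.finrank ℂ (↥(qppBonds L c) → 𝔸) *
          (-Real.log (1 - 18 * Mq (1 / (2816 * ((d : ℝ) + 1) * L)) 1 *
            (((L : ℝ) ^ d / L) / (1 - (L : ℝ) ^ d / L * (24 * ε))) * r)))) / (Rad - 1)))) / (1 - δ)) := by
  have hLr : (0 : ℝ) < L := by exact_mod_cast hL
  have hR : (0 : ℝ) < 1 / (2816 * ((d : ℝ) + 1) * L) := by positivity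
  exact slotAC_linearizedWindow_of_Q (κX := κ𝔸 𝔸) (κY := κΓ 𝔸 L c) μE μK κ𝔸_invol κΓ_invol ζ
    (Qt := fun z => QtΓ L (V z) c) (hop := fun z => hopΓAt hL (V z) hε0 hε c (hWc z) (hV z) (hV' z) hbud) hR
    (fun z => analyticOnNhd_Qtilde_gammaT hL (hV z) (hV' z) hε0 hε (hWc z)) (fun z => QtΓ_zero L (V z) c)
    (fun z => QtΓ_bound_one hL (hV z) (hV' z) hε0 hε (hWc z))
    (fun z => QtΓ_conj hL (hVu z) (hV z) (hV' z) hε0 hε (hWc z))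
    (fun z X => fderiv_QtΓ_hopΓAt hL hε0 hε (hWc z) (hV z) (hV' z) hbud X) (hop_bound_nonneg hL hbud)
    (fun z X => norm_hopΓAt_le hL (V z) hε0 hε c (hWc z) (hV z) (hV' z) hbud X)
    (fun z X => hopΓAt_star hL (V z) hε0 hε c (hWc z) (hV z) (hV' z) hbud
      (hGenAt_star_gammaT_unitary hL (V z) hε0 hε c (hWc z) (hV z) (hV' z) hbud (hVu z)) X)
    hq2 hRC hDball hDfix Ψ hΨ hσm hσ hΦ hG hu hGsupp hfin Ttr hN hPu hol hcont Pw Gw 𝓔 W Jco hFdict hudict hWr hr0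
    hrε hJW hJ hRad hAN hGW hsw1 hsw0 hlw0 hdw0 hE hB𝓔 hθ hδ0 hδ1 hρ0 hρ hβ hSM


/-! ## §3 The matrix typing `𝔸 := M_N(ℂ)`: UNITARY backgrounds PLAQUETTE-REGULAR ON THE BOX OF `c` -/

section MatrixTyping

open scoped Matrix.Norms.L2Operator

/-- **NE7c-S91 AT THE MATRIX TYPING, REGIME = PRINT'S PLAQUETTE REGULARITY ON THE TWO-BLOCK BOX OF `c` ALONE.**
Row S60's `slotAC_linearizedWindow_gammaT_matrix` with the plaquette binder LOCATED: `‖V z (∂p) − 1‖ ≤ ε₀` only for the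
plaquettes with all corners in `[L c₋, L c₋ + pairTop L c.2]` ([B12] p. 254 ∕ B11 (19)–(21) TYPE — at a live slot these are
co-tested plaquettes of `□^{∼4}`, file 2 `h44c_of_cotests`), `1 ≤ d`, `24·d·L^{d+1}·ε₀ < 1`; the loop regime `ε := ω(ε₀)`
AT `c` is file 2's `loopsAt_of_box` (`B12PlaquetteLoop267.norm_loopW_sub_one_le_local`), thresholds and budget
`thresholds_of_small`.  Everything else as in §2. [folklore] -/
theorem slotAC_linearizedWindow_gammaT_local_matrix {N : ℕ} [NeZero N]
    [MeasurableSpace (Matrix (Fin N) (Fin N) ℂ)] [BorelSpace (Matrix (Fin N) (Fin N) ℂ)]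
    [MeasurableSpace (↥(qppBonds L c) → Matrix (Fin N) (Fin N) ℂ)] [BorelSpace (↥(qppBonds L c) → Matrix (Fin N) (Fin N) ℂ)]
    (hL : 0 < L) (hd : 1 ≤ d) (μE : Measure (realSub (κΓ (Matrix (Fin N) (Fin N) ℂ) L c))) [μE.IsAddHaarMeasure]
    {Kf : Type*} [NormedAddCommGroup Kf] [NormedSpace ℝ Kf] [MeasurableSpace Kf] [BorelSpace Kf]
    [FiniteDimensional ℝ Kf] (μK : Measure Kf) [μK.IsAddHaarMeasure]
    {A : Type*} [NormedRing A] [NormedAlgebra ℂ A] [CompleteSpace A] [NormOneClass A]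
    {Z : Type*} [MeasurableSpace Z] (ζ : Measure Z) [SFinite ζ]
    -- PRINT'S REGULARITY of the exterior-indexed unitary background, `ε₀` uniform
    {V : Z → ZdEdge d → (Matrix (Fin N) (Fin N) ℂ)ˣ}
    (hVu : ∀ z b, (V z b : Matrix (Fin N) (Fin N) ℂ) ∈ unitary (Matrix (Fin N) (Fin N) ℂ))
    (hV : ∀ z b, ‖((V z b : (Matrix (Fin N) (Fin N) ℂ)ˣ) : Matrix (Fin N) (Fin N) ℂ)‖ ≤ 1)
    (hV' : ∀ z b, ‖(((V z b)⁻¹ : (Matrix (Fin N) (Fin N) ℂ)ˣ) : Matrix (Fin N) (Fin N) ℂ)‖ ≤ 1)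
    {ε₀ : ℝ} (hε₀ : 0 ≤ ε₀) (hsmall : 24 * (d : ℝ) * (L : ℝ) ^ (d + 1) * ε₀ < 1)
    (h44c : ∀ z (p : Fin d → ℤ) (i j : Fin d), i ≠ j → blockBase L c.1 ≤ p →
      p + Pi.single i 1 + Pi.single j 1 ≤ blockBase L c.1 + pairTop L c.2 →
      ‖((plaquetteHolonomyZd (V z) p i j : (Matrix (Fin N) (Fin N) ℂ)ˣ) : Matrix (Fin N) (Fin N) ℂ) - 1‖ ≤ ε₀)
    -- the window radius
    {εw : ℝ} (hq2 : 9 * Mq (1 / (2816 * ((d : ℝ) + 1) * L)) 1 *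
      (((L : ℝ) ^ d / L) / (1 - (L : ℝ) ^ d / L * (24 * omegaC d L ε₀))) * εw ≤ 1 / 2)
    (hRC : 3 * εw ≤ 1 / (2816 * ((d : ℝ) + 1) * L))
    -- a solution of print's fixed-point equation per exterior point
    {Dt : Z → (↥(qppBonds L c) → Matrix (Fin N) (Fin N) ℂ) → Matrix (Fin N) (Fin N) ℂ}
    (hDball : ∀ z, ∀ B : ↥(qppBonds L c) → Matrix (Fin N) (Fin N) ℂ, ‖B‖ < εw →
      Dt z B ∈ closedBall (0 : Matrix (Fin N) (Fin N) ℂ) (4 * Mq (1 / (2816 * ((d : ℝ) + 1) * L)) 1 * εw ^ 2))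
    (hDfix : ∀ z, ∀ B : ↥(qppBonds L c) → Matrix (Fin N) (Fin N) ℂ, ‖B‖ < εw →
      nonlin (QtΓ L (V z) c) (B - hopΓAt hL (V z) (omegaC_nonneg hL hd hε₀) (thresholds_of_small hL hd hε₀ hsmall).1 c
        (loopsAt_of_box hL (V z) (hV z) (hV' z) hε₀ c (h44c z)) (hV z) (hV' z)
        (thresholds_of_small hL hd hε₀ hsmall).2 (Dt z B)) = Dt z B)
    -- the splitting along the real `DQ̃(0)` and its section
    (Ψ : Z → (Kf × realSub (κ𝔸 (Matrix (Fin N) (Fin N) ℂ))) ≃L[ℝ] realSub (κΓ (Matrix (Fin N) (Fin N) ℂ) L c))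
    (hΨ : ∀ z y, ((Ψ z).symm y).2 = TΓ L (V z) c y)
    {σ : Z → realSub (κ𝔸 (Matrix (Fin N) (Fin N) ℂ)) → realSub (κΓ (Matrix (Fin N) (Fin N) ℂ) L c)}
    (hσm : ∀ z, Measurable (σ z)) (hσ : ∀ z a, ((Ψ z).symm (σ z a)).2 = a)
    -- the chart by its defining equation
    {Φ : Z → realSub (κΓ (Matrix (Fin N) (Fin N) ℂ) L c) → realSub (κΓ (Matrix (Fin N) (Fin N) ℂ) L c)}
    (hΦ : ∀ z, Φ z = fun B => B - hΓAt hL (V z) (omegaC_nonneg hL hd hε₀) (thresholds_of_small hL hd hε₀ hsmall).1 c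
        (loopsAt_of_box hL (V z) (hV z) (hV' z) hε₀ c (h44c z)) (hV z) (hV' z)
        (thresholds_of_small hL hd hε₀ hsmall).2 (DtΓℝ L c (Dt z) εw B))
    -- the realized slot law
    {G : realSub (κΓ (Matrix (Fin N) (Fin N) ℂ) L c) × Z → ℝ≥0∞} (hG : Measurable G)
    {u : realSub (κΓ (Matrix (Fin N) (Fin N) ℂ) L c) × Z → ℝ} (hu : Measurable u)
    (hGsupp : ∀ z y, G (y, z) ≠ 0 →
      y ∈ Φ z '' {y : realSub (κΓ (Matrix (Fin N) (Fin N) ℂ) L c) | ‖incl (κΓ (Matrix (Fin N) (Fin N) ℂ) L c) y‖ < εw})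
    (hfin : ∀ z a, (μK.withDensity fun x =>
      ({y : realSub (κΓ (Matrix (Fin N) (Fin N) ℂ) L c) | ‖incl (κΓ (Matrix (Fin N) (Fin N) ℂ) L c) y‖ < εw}).indicator
        (fun y => G (Φ z y, z)) (σ z a + Ψ z (x, 0))) univ ≠ ∞)
    -- level data per exterior point AND average value, in the fibre coordinate
    (Ttr : TraceData A) (hN : 0 < Ttr.N) {ι κ : Type*} {Pu : Finset ι} (hPu : Pu.Nonempty)
    (hol : Z → realSub (κ𝔸 (Matrix (Fin N) (Fin N) ℂ)) → ι → Kf → A) (hcont : ∀ z a, ∀ p ∈ Pu, Continuous (hol z a p))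
    (Pw : Finset κ) (Gw : Z → realSub (κ𝔸 (Matrix (Fin N) (Fin N) ℂ)) → κ → Kf → A)
    (𝓔 : Z → realSub (κ𝔸 (Matrix (Fin N) (Fin N) ℂ)) → Kf → ℝ) (W : Z → realSub (κ𝔸 (Matrix (Fin N) (Fin N) ℂ)) → Set Kf)
    (Jco : Z → realSub (κ𝔸 (Matrix (Fin N) (Fin N) ℂ)) → Kf → ℝ≥0∞) {θ δ ρ β Rad H B𝓔 r : ℝ} {sw lw dw : κ → ℝ}
    -- DICTIONARY at the charted point — the DENSITY ALONE (the [dict] residual of W-d, node O)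
    (hFdict : ∀ z a x,
      ({y : realSub (κΓ (Matrix (Fin N) (Fin N) ℂ) L c) | ‖incl (κΓ (Matrix (Fin N) (Fin N) ℂ) L c) y‖ < εw}).indicator
        (fun y => G (Φ z y, z)) (σ z a + Ψ z (x, 0)) = Jco z a x * weight Ttr β Pw (Gw z a) (𝓔 z a) x)
    (hudict : ∀ z a x,
      ({y : realSub (κΓ (Matrix (Fin N) (Fin N) ℂ) L c) | ‖incl (κΓ (Matrix (Fin N) (Fin N) ℂ) L c) y‖ < εw}).indicator
        (fun y => G (Φ z y, z)) (σ z a + Ψ z (x, 0)) ≠ 0 →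
      u (Φ z (σ z a + Ψ z (x, 0)), z) = classifier hPu (hol z a) x)
    -- window placement
    (hWr : ∀ z a, ∀ x ∈ W z a, ‖σ z a‖ + Rad * ‖Ψ z (x, 0)‖ ≤ r) (hr0 : 0 ≤ r) (hrε : r < εw)
    -- SM-L5/L6
    (hJW : ∀ z a x, Jco z a x ≠ 0 → x ∈ W z a)
    (hJ : ∀ z a x, ∀ a' : ℝ, 0 ≤ a' → Jco z a x ≤ Jco z a (Real.exp (-a') • x))
    -- SM-L1
    (hRad : 1 < Rad)
    (hAN : ∀ z a, ∀ x ∈ W z a, ∀ p ∈ Pu, ∃ f : ℂ → A, DifferentiableOn ℂ f (ball 0 Rad) ∧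
      (∀ w ∈ ball (0 : ℂ) Rad, ‖f w‖ ≤ H) ∧ f 0 = 0 ∧
      ∀ c' : ℝ, 0 ≤ c' → c' ≤ 1 → f (c' : ℂ) = hol z a p (c' • x) - 1)
    -- SM-L3
    (hGW : ∀ z a, ∀ x ∈ W z a, ∀ p ∈ Pw, ∃ gw : List (MLetter A × ℝ × ℝ), (∀ y ∈ gw, y.1.Good Ttr.τ y.2.1 y.2.2) ∧
      sSum gw ≤ sw p ∧ lSum gw ≤ lw p ∧ mdFro (gw.map Prod.fst) ≤ dw p ∧
      ∀ c' : ℝ, 0 ≤ c' → c' ≤ 1 → mwordEval c' (gw.map Prod.fst) = Gw z a p (c' • x))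
    (hsw1 : ∀ p ∈ Pw, sw p ≤ 1) (hsw0 : ∀ p ∈ Pw, 0 ≤ sw p) (hlw0 : ∀ p ∈ Pw, 0 ≤ lw p)
    (hdw0 : ∀ p ∈ Pw, 0 ≤ dw p)
    -- SM-L4 for the OTHER terms
    (hE : ∀ z a, ∀ x ∈ W z a, ∀ c' : ℝ, 1 / 2 ≤ c' → c' ≤ 1 → 𝓔 z a (c' • x) ≤ 𝓔 z a x + (1 - c') * B𝓔)
    (hB𝓔 : 0 ≤ B𝓔)
    -- numbers + (SM)
    (hθ : 0 < θ) (hδ0 : 0 ≤ δ) (hδ1 : δ < 1) (hρ0 : 0 ≤ ρ) (hρ : ρ ≤ (1 - δ) / 2) (hβ : 0 ≤ β)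
    (hSM : 36 * H * 1 ^ 2 / (Rad - 1) ^ 2 ≤ δ * θ) :
    SlotAntiConcentration ((μE.prod ζ).withDensity G) u θ ρ
      (2 * ((Module.finrank ℝ Kf : ℝ) + (β * ∑ p ∈ Pw, lw p * (dw p + 4 * sw p) +
        (B𝓔 + 3 * (2 * (Module.finrank ℂ (↥(qppBonds L c) → Matrix (Fin N) (Fin N) ℂ) *
          (-Real.log (1 - 18 * Mq (1 / (2816 * ((d : ℝ) + 1) * L)) 1 *
            (((L : ℝ) ^ d / L) / (1 - (L : ℝ) ^ d / L * (24 * omegaC d L ε₀))) * r)))) / (Rad - 1)))) / (1 - δ)) :=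
  slotAC_linearizedWindow_gammaT_local hL μE μK ζ hVu hV hV' (omegaC_nonneg hL hd hε₀)
    (thresholds_of_small hL hd hε₀ hsmall).1 (fun z => loopsAt_of_box hL (V z) (hV z) (hV' z) hε₀ c (h44c z))
    (thresholds_of_small hL hd hε₀ hsmall).2 hq2 hRC
    hDball hDfix Ψ hΨ hσm hσ hΦ hG hu hGsupp hfin Ttr hN hPu hol hcont Pw Gw 𝓔 W Jco hFdict hudict hWr hr0 hrε hJW hJ hRad
    hAN hGW hsw1 hsw0 hlw0 hdw0 hE hB𝓔 hθ hδ0 hδ1 hρ0 hρ hβ hSM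

end MatrixTyping

end Summit.QuantumFields.BalabanUV.T4Continuum.ShellMeasureLinearizedEndGammaTLocal

end
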